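import Literature.NumberTheory.LFunctions.KMVPrimeAveragedSecondSqueeze
import Literature.NumberTheory.LFunctions.KMVDiagonalSlack
import HarnessLib

/-!
# The ONE-SIDED form of the prime-averaged squeeze: a band along good primes for the normalised
mollified second moment bounds the second main term (Kowalski–Michel–VanderKam 2000, §6 p. 19)

Topic `Literature/NumberTheory/LFunctions` (cell landau-siegel §D, family route `PrimeLevelFamEdge`,
crux K_B = `BeyondDiagonalBeatsQuarter`, stmt-Parity-20343; D-0130 line `prime-averaged-squeeze`, its
fallback/reshape form). PROVED, 0 named facts; NO Petersson input (R2-G44 hygiene). Companion of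
`KMVPrimeAveragedSecondSqueeze` (p531103; averaged DIAGONAL-ONLY display ⇒ `T₂ = 0`): a BAND for the
normalised second moment `‖Q^h(X²,1)‖/‖mainScale‖` at infinitely many good primes (for each `Δ'` in a
window `(1, b)`) already gives the crux, FACT-FREE (positivity: `Q^h(P,1)` is a non-negative real).

WHAT IS PROVED. §1 `QhPQ_one_re_nonneg`, `norm_QhPQ_one`, `mainScale_eq_ofReal`, `norm_mainScale`
(the second moment at `Q = 1` is a non-negative real; the scale is the positive real
`2(π²/6)² q̂/(Δ'² log² q̂)`). §2 `abs_normQhPQ_div_sub_le` (under `MomentAsymptotics`, at good primes past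
a threshold, `|‖Q^h(P,1)‖/‖mainScale‖ − (second + T₂)| ≤ C/log q̂`); `secondMainTerm_nonneg_factFree`
(`0 ≤ second + T₂` with NO Petersson input — the corollary `secondMainTerm_nonneg` of
`KMVSecondMainTermFloor` takes `kowalskiMichel2000_petersson`, refuted as typed p528813);
`secondMainTerm_le_of_ceilingAlongGoodPrimes` / `le_secondMainTerm_of_floorAlongGoodPrimes`. §3 the
value-crux body from the band `[δ, 2·lin² − δ]` along good primes at `(X², 1)` on `(1, b)` plus `T₁ = 0`
(resp. plus Bettin's fact and the `X²` main term). §4 `bandAlongGoodPrimes_X_sq_of_secondDefect_small_io`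
(«diagonal-only infinitely often» ⇒ the band, `δ = 2(Δ'−1)/Δ'`), `secondDefect_small_io_of_average`
(the averaged display ⇒ «infinitely often»), `bandAlongGoodPrimes_X_sq_of_secondDefect_average`.

WHAT THIS IS NOT: no claim that any such band holds beyond the diagonal (famE-02 OPEN IN PRINT); a
REDUCTION. «The programme SEARCHES and TYPES; no claim about Landau–Siegel zeros, Theorems 1–2 of
arXiv:2211.02515 or a repaired Margin232 until a kernel theorem says so.»

## References

* [KowalskiMichelVanderKam2000] E. Kowalski, P. Michel, J. VanderKam, J. reine angew. Math. 526
  (2000) 1–34: (7), §6 p. 19 (second-moment display), Thm. 6.1 (32), §7 p. 21.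
  [held: paper:doi-10-1515-crll-2000-074 p0007, p0019–p0021]
* [Bettin2017] S. Bettin, Thm. 1.1. [held: paper:arxiv-1605.02440 p0003]
-/

noncomputable section

namespace Literature.NumberTheory.LFunctions.KMV2000

open Polynomial Finset
/-! ## §1. The mollified second moment at `Q = 1` is a non-negative real; the main scale -/

open scoped _root_.Real

variable {q : ℕ} [NeZero q]

/-- `Q^h(P, 1)` at level `q` is a non-negative real number (a finite sum of `ω_f · ‖Λ(f,½) M_P(f)‖²`
with `ω_f ≥ 0`): its real part is `≥ 0`. [cite: KowalskiMichelVanderKam2000, (7) and §6 p. 19] -/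
theorem QhPQ_one_re_nonneg (P : ℝ[X]) (M : ℝ) : 0 ≤ (QhPQ q P 1 M).re := by
  rw [QhPQ_one_eq_sum, Complex.ofReal_re]
  exact Finset.sum_nonneg fun f _ ↦
    mul_nonneg (IwaniecSarnak.harmonicWeight_nonneg le_rfl f) (sq_nonneg _)

/-- `Q^h(P, 1)` equals (the cast of) its real part. [cite: KowalskiMichelVanderKam2000, (7) and §6 p. 19] -/
theorem QhPQ_one_eq_ofReal_re (P : ℝ[X]) (M : ℝ) :
    QhPQ q P 1 M = (((QhPQ q P 1 M).re : ℝ) : ℂ) := by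
  rw [QhPQ_one_eq_sum, Complex.ofReal_re]

/-- `‖Q^h(P, 1)‖ = re Q^h(P, 1)`. [cite: KowalskiMichelVanderKam2000, (7) and §6 p. 19] -/
theorem norm_QhPQ_one (P : ℝ[X]) (M : ℝ) : ‖QhPQ q P 1 M‖ = (QhPQ q P 1 M).re := by
  rw [QhPQ_one_eq_ofReal_re, Complex.norm_real, Complex.ofReal_re, Real.norm_eq_abs,
    abs_of_nonneg (QhPQ_one_re_nonneg P M)]

/-- The main scale at a non-zero level is the positive real `2ζ(2)² q̂/(Δ'² log² q̂)`, `ζ(2) = π²/6`.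
[cite: KowalskiMichelVanderKam2000, §6 p. 19 (second-moment display)] -/
theorem mainScale_eq_ofReal (Δ' : ℝ) :
    mainScale q Δ' =
      ((2 * (π ^ 2 / 6) ^ 2 * (qhat q / (Δ' ^ 2 * Real.log (qhat q) ^ 2)) : ℝ) : ℂ) := by
  unfold mainScale
  rw [dif_neg (NeZero.ne q), riemannZeta_two]
  push_cast
  ring

/-- The norm of the main scale: `‖mainScale q Δ'‖ = 2(π²/6)² q̂/(Δ'² log² q̂)` once `q ≥ 40`
(so that `q̂ > 1`). [cite: KowalskiMichelVanderKam2000, §6 p. 19 (second-moment display)] -/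
theorem norm_mainScale (hq : 40 ≤ q) (Δ' : ℝ) :
    ‖mainScale q Δ'‖ = 2 * (π ^ 2 / 6) ^ 2 * (qhat q / (Δ' ^ 2 * Real.log (qhat q) ^ 2)) := by
  have hqhat : 0 < qhat q := lt_trans one_pos (one_lt_qhat hq)
  rw [mainScale_eq_ofReal, Complex.norm_real, Real.norm_eq_abs, abs_of_nonneg (by positivity)]

/-! ## §2. The normalised second moment tracks `second + T₂` at the good primes -/

/-- **The second display, normalised.** Under `MomentAsymptotics Δlo Δhi T₁ T₂`, at `Q = 1`, an
admissible `P` and `Δ' ∈ (Δlo, Δhi]`, `Δ' > 0`: there are `C ≥ 0` and `q₀` such that at every good prime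
`q ≥ q₀` (`q̂^{Δ'} ∉ ℕ`) one has `1 ≤ log q̂`, `0 < ‖mainScale q Δ'‖` and
`|‖Q^h(P,1)‖/‖mainScale q Δ'‖ − (second + T₂)| ≤ C/log q̂(q)` (`Q^h` is a non-negative real, the scale a
positive real, the printed error `O(q̂ log⁻³ q̂)` is `O(1/log q̂)` relative to the scale).
[cite: KowalskiMichelVanderKam2000, §6 p. 19 (second-moment display)] -/
theorem abs_normQhPQ_div_sub_le {Δlo Δhi : ℝ} {T₁ T₂ : ℝ → ℝ[X] → ℝ[X] → ℝ}
    (h : MomentAsymptotics Δlo Δhi T₁ T₂) {P : ℝ[X]} (hP : Admissible P)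
    {Δ' : ℝ} (h1 : Δlo < Δ') (h2 : Δ' ≤ Δhi) (hΔ' : 0 < Δ') :
    ∃ C : ℝ, 0 ≤ C ∧ ∃ q₀ : ℕ, ∀ (q : ℕ) [NeZero q], q.Prime → q₀ ≤ q →
      (∀ n : ℕ, (n : ℝ) ≠ qhat q ^ Δ') →
        1 ≤ Real.log (qhat q) ∧ 0 < ‖mainScale q Δ'‖ ∧
          |‖QhPQ q P 1 (qhat q ^ Δ')‖ / ‖mainScale q Δ'‖ -
              (secondMomentForm Δ' P 1 + T₂ Δ' P 1)| ≤ C / Real.log (qhat q) := by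
  obtain ⟨C, q₀, hC⟩ := h P 1 hP isEvenOrOdd_one Δ' h1 h2
  obtain ⟨N, hN⟩ := exists_log_qhat_ge 1
  set α : ℝ := π ^ 2 / 6 with hα_def
  have hα : 0 < α := by positivity
  refine ⟨|C| * Δ' ^ 2 / (2 * α ^ 2), by positivity, max q₀ (max N 40), fun q _ hq hq₀ hgood ↦ ?_⟩
  have hq₀' : q₀ ≤ q := le_trans (le_max_left _ _) hq₀
  have hqN : N ≤ q := le_trans (le_trans (le_max_left _ _) (le_max_right _ _)) hq₀
  have hq40 : 40 ≤ q := le_trans (le_trans (le_max_right _ _) (le_max_right _ _)) hq₀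
  have hlg : 1 ≤ Real.log (qhat q) := hN q hqN
  have hlgpos : 0 < Real.log (qhat q) := by linarith
  have hqhatpos : 0 < qhat q := lt_trans one_pos (one_lt_qhat hq40)
  set c₂ : ℝ := secondMomentForm Δ' P 1 + T₂ Δ' P 1 with hc₂
  set m : ℝ := 2 * α ^ 2 * (qhat q / (Δ' ^ 2 * Real.log (qhat q) ^ 2)) with hm_def
  have hm : 0 < m := by positivity
  have hnm : ‖mainScale q Δ'‖ = m := by rw [norm_mainScale hq40, hm_def]
  refine ⟨hlg, by rw [hnm]; exact hm, ?_⟩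
  obtain ⟨-, b2⟩ := hC q hq hq₀' hgood
  set R : ℝ := (QhPQ q P 1 (qhat q ^ Δ')).re with hR_def
  have hQ : QhPQ q P 1 (qhat q ^ Δ') = ((R : ℝ) : ℂ) := QhPQ_one_eq_ofReal_re P _
  have hS : (2 * riemannZeta 2 ^ 2 * ((qhat q / (Δ' ^ 2 * Real.log (qhat q) ^ 2) : ℝ) : ℂ)) *
      ((c₂ : ℝ) : ℂ) = ((m * c₂ : ℝ) : ℂ) := by
    rw [riemannZeta_two, hm_def, hα_def]; push_cast; ring
  rw [hQ, hS, ← Complex.ofReal_sub, Complex.norm_real, Real.norm_eq_abs] at b2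
  -- `|R − m c₂| ≤ |C| q̂ log⁻³`
  have b3 : |R - m * c₂| ≤ |C| * qhat q * (Real.log (qhat q))⁻¹ ^ 3 := by
    refine b2.trans ?_
    have hs : 0 ≤ qhat q * (Real.log (qhat q))⁻¹ ^ 3 := by positivity
    rw [mul_assoc, mul_assoc]
    exact mul_le_mul_of_nonneg_right (le_abs_self C) hs
  rw [norm_QhPQ_one, hnm, ← hR_def]
  have e₁ : R / m - c₂ = (R - m * c₂) / m := by field_simp
  have e₂ : |C| * qhat q * (Real.log (qhat q))⁻¹ ^ 3 / m =
      |C| * Δ' ^ 2 / (2 * α ^ 2) / Real.log (qhat q) := by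
    rw [hm_def]; field_simp
  rw [e₁, abs_div, abs_of_pos hm, div_le_iff₀ hm, ← e₂, div_mul_cancel₀ _ hm.ne']
  exact b3

/-- **Fact-free positivity of the second main term.** Under `MomentAsymptotics Δlo Δhi T₁ T₂`, at
every admissible `P`, `Q = 1` and `Δ' ∈ (Δlo, Δhi]`, `Δ' > 0`, with good primes unbounded:
`0 ≤ secondMomentForm Δ' P 1 + T₂ Δ' P 1` — because `Q^h(P,1) ≥ 0` at every level. (No Petersson input;
replaces the use of `secondMainTerm_nonneg` of `KMVSecondMainTermFloor`, whose Petersson hypothesis is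
refuted as typed.) [cite: KowalskiMichelVanderKam2000, (7) and §6 p. 19] -/
theorem secondMainTerm_nonneg_factFree {Δlo Δhi : ℝ} {T₁ T₂ : ℝ → ℝ[X] → ℝ[X] → ℝ}
    (h : MomentAsymptotics Δlo Δhi T₁ T₂) {P : ℝ[X]} (hP : Admissible P)
    {Δ' : ℝ} (h1 : Δlo < Δ') (h2 : Δ' ≤ Δhi) (hΔ' : 0 < Δ') (hgood : GoodPrimesUnbounded Δ') :
    0 ≤ secondMomentForm Δ' P 1 + T₂ Δ' P 1 := by
  obtain ⟨C, hC0, q₀, hC⟩ := abs_normQhPQ_div_sub_le h hP h1 h2 hΔ'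
  set c₂ : ℝ := secondMomentForm Δ' P 1 + T₂ Δ' P 1
  by_contra hneg
  have hneg : c₂ < 0 := lt_of_not_ge hneg
  -- pick a good prime with `C / log q̂ < −c₂`
  obtain ⟨N₁, hN₁⟩ := exists_log_qhat_ge (2 * C / (-c₂) + 1)
  obtain ⟨q, inst, hq, hqge, hgq⟩ := hgood (max q₀ N₁)
  obtain ⟨hlg, hm, hb⟩ := hC q hq (le_trans (le_max_left _ _) hqge) hgq
  have hlgB := hN₁ q (le_trans (le_max_right _ _) hqge)
  have hlgpos : 0 < Real.log (qhat q) := by linarith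
  have hratio : 0 ≤ ‖QhPQ q P 1 (qhat q ^ Δ')‖ / ‖mainScale q Δ'‖ := by positivity
  have hc₂ne : -c₂ ≠ 0 := (neg_pos.2 hneg).ne'
  have hCle : C / Real.log (qhat q) < -c₂ := by
    rw [div_lt_iff₀ hlgpos]
    have e : 2 * C / -c₂ * -c₂ = 2 * C := div_mul_cancel₀ _ hc₂ne
    nlinarith [mul_le_mul_of_nonneg_left hlgB (le_of_lt (neg_pos.2 hneg))]
  have := (abs_le.1 hb).2
  linarith

/-- **Ceiling along good primes bounds the second main term from above.** Under
`MomentAsymptotics Δlo Δhi T₁ T₂`, at admissible `P`, `Q = 1`, `Δ' ∈ (Δlo, Δhi]`, `Δ' > 0`: if for every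
`q₀` some good prime `q ≥ q₀` has `‖Q^h(P,1)‖ ≤ K · ‖mainScale q Δ'‖` (length `q̂^{Δ'}`), then
`secondMomentForm Δ' P 1 + T₂ Δ' P 1 ≤ K`. [cite: KowalskiMichelVanderKam2000, §6 p. 19 (second-moment display)] -/
theorem secondMainTerm_le_of_ceilingAlongGoodPrimes {Δlo Δhi : ℝ} {T₁ T₂ : ℝ → ℝ[X] → ℝ[X] → ℝ}
    (h : MomentAsymptotics Δlo Δhi T₁ T₂) {P : ℝ[X]} (hP : Admissible P)
    {Δ' : ℝ} (h1 : Δlo < Δ') (h2 : Δ' ≤ Δhi) (hΔ' : 0 < Δ') {K : ℝ}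
    (hceil : ∀ q₀ : ℕ, ∃ q : ℕ, ∃ _ : NeZero q, q₀ ≤ q ∧ q.Prime ∧
      (∀ n : ℕ, (n : ℝ) ≠ qhat q ^ Δ') ∧
        ‖QhPQ q P 1 (qhat q ^ Δ')‖ ≤ K * ‖mainScale q Δ'‖) :
    secondMomentForm Δ' P 1 + T₂ Δ' P 1 ≤ K := by
  obtain ⟨C, hC0, q₀, hC⟩ := abs_normQhPQ_div_sub_le h hP h1 h2 hΔ'
  set c₂ : ℝ := secondMomentForm Δ' P 1 + T₂ Δ' P 1
  refine le_of_forall_pos_lt_add fun ε hε ↦ ?_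
  obtain ⟨N₁, hN₁⟩ := exists_log_qhat_ge (C / ε + 1)
  obtain ⟨q, inst, hqge, hq, hgq, hle⟩ := hceil (max q₀ N₁)
  obtain ⟨hlg, hm, hb⟩ := hC q hq (le_trans (le_max_left _ _) hqge) hgq
  have hlgB := hN₁ q (le_trans (le_max_right _ _) hqge)
  have hlgpos : 0 < Real.log (qhat q) := by linarith
  have hratio : ‖QhPQ q P 1 (qhat q ^ Δ')‖ / ‖mainScale q Δ'‖ ≤ K := by
    rw [div_le_iff₀ hm]; exact hle
  have hCle : C / Real.log (qhat q) < ε := by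
    rw [div_lt_iff₀ hlgpos]
    have e : C / ε * ε = C := div_mul_cancel₀ _ hε.ne'
    nlinarith [mul_le_mul_of_nonneg_left hlgB hε.le]
  have := (abs_le.1 hb).1
  linarith

/-- **Floor along good primes bounds the second main term from below.** Dually, if for every `q₀`
some good prime `q ≥ q₀` has `κ · ‖mainScale q Δ'‖ ≤ ‖Q^h(P,1)‖`, then
`κ ≤ secondMomentForm Δ' P 1 + T₂ Δ' P 1`. [cite: KowalskiMichelVanderKam2000, §6 p. 19 (second-moment display)] -/
theorem le_secondMainTerm_of_floorAlongGoodPrimes {Δlo Δhi : ℝ} {T₁ T₂ : ℝ → ℝ[X] → ℝ[X] → ℝ}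
    (h : MomentAsymptotics Δlo Δhi T₁ T₂) {P : ℝ[X]} (hP : Admissible P)
    {Δ' : ℝ} (h1 : Δlo < Δ') (h2 : Δ' ≤ Δhi) (hΔ' : 0 < Δ') {κ : ℝ}
    (hfloor : ∀ q₀ : ℕ, ∃ q : ℕ, ∃ _ : NeZero q, q₀ ≤ q ∧ q.Prime ∧
      (∀ n : ℕ, (n : ℝ) ≠ qhat q ^ Δ') ∧
        κ * ‖mainScale q Δ'‖ ≤ ‖QhPQ q P 1 (qhat q ^ Δ')‖) :
    κ ≤ secondMomentForm Δ' P 1 + T₂ Δ' P 1 := by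
  obtain ⟨C, hC0, q₀, hC⟩ := abs_normQhPQ_div_sub_le h hP h1 h2 hΔ'
  set c₂ : ℝ := secondMomentForm Δ' P 1 + T₂ Δ' P 1
  refine le_of_forall_pos_lt_add fun ε hε ↦ ?_
  obtain ⟨N₁, hN₁⟩ := exists_log_qhat_ge (C / ε + 1)
  obtain ⟨q, inst, hqge, hq, hgq, hle⟩ := hfloor (max q₀ N₁)
  obtain ⟨hlg, hm, hb⟩ := hC q hq (le_trans (le_max_left _ _) hqge) hgq
  have hlgB := hN₁ q (le_trans (le_max_right _ _) hqge)
  have hlgpos : 0 < Real.log (qhat q) := by linarith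
  have hratio : κ ≤ ‖QhPQ q P 1 (qhat q ^ Δ')‖ / ‖mainScale q Δ'‖ := by
    rw [le_div_iff₀ hm]; exact hle
  have hCle : C / Real.log (qhat q) < ε := by
    rw [div_lt_iff₀ hlgpos]
    have e : C / ε * ε = C := div_mul_cancel₀ _ hε.ne'
    nlinarith [mul_le_mul_of_nonneg_left hlgB hε.le]
  have := (abs_le.1 hb).2
  linarith

/-! ## §3. The ONE-SIDED form of the line: a band along good primes suffices -/

/-- **The value crux from a band along good primes (the one-sided twin of the averaged display).**
Let `(1, Δ]` carry MA-consistent `(T₁, T₂)`. Suppose that for every `Δ' ∈ (1, b)` there is `δ > 0`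
such that at infinitely many good primes the normalised second moment at `(X², 1)`, length `q̂^{Δ'}`,
lies in the band `[δ, 2·lin² − δ]` (`lin = linForm Δ' X² 1 = 2`): `δ‖mainScale‖ ≤ ‖Q^h‖ ≤ (2·lin² − δ)‖mainScale‖`.
Then `δ ≤ second + T₂ ≤ 2·lin² − δ` there (§2), and with `T₁(·, X², 1) = 0` on `(1, min Δ 2)` the profile
`X²` has value `lin²/(2(second + T₂)) > ¼` on `(1, min Δ (min b 2))` — what the value crux needs, no more.
[cite: KowalskiMichelVanderKam2000, Thm. 6.1 (32); §6 p. 19] -/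
theorem beatsQuarter_window_of_bandAlongGoodPrimes_X_sq {b : ℝ} (hb : 1 < b)
    (hband : ∀ Δ' : ℝ, 1 < Δ' → Δ' < b → ∃ δ : ℝ, 0 < δ ∧ ∀ q₀ : ℕ, ∃ q : ℕ, ∃ _ : NeZero q,
      q₀ ≤ q ∧ q.Prime ∧ (∀ n : ℕ, (n : ℝ) ≠ qhat q ^ Δ') ∧
        δ * ‖mainScale q Δ'‖ ≤ ‖QhPQ q (X ^ 2) 1 (qhat q ^ Δ')‖ ∧
          ‖QhPQ q (X ^ 2) 1 (qhat q ^ Δ')‖ ≤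
            (2 * linForm Δ' (X ^ 2) 1 ^ 2 - δ) * ‖mainScale q Δ'‖)
    {Δ : ℝ} (hΔ : 1 < Δ) {T₁ T₂ : ℝ → ℝ[X] → ℝ[X] → ℝ} (hMA : MomentAsymptotics 1 Δ T₁ T₂)
    (hT₁ : ∀ Δ' : ℝ, 1 < Δ' → Δ' < min Δ 2 → T₁ Δ' (X ^ 2) 1 = 0) :
    ∃ a' b' : ℝ, 1 ≤ a' ∧ a' < b' ∧ b' ≤ Δ ∧ a' < 3 / 2 ∧ ∃ P : ℝ[X], Admissible P ∧
      ∀ Δ' : ℝ, a' < Δ' → Δ' < b' →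
        1 / 4 < (linForm Δ' P 1 + T₁ Δ' P 1) ^ 2 /
          (2 * (secondMomentForm Δ' P 1 + T₂ Δ' P 1)) := by
  refine ⟨1, min Δ (min b 2), le_rfl, lt_min hΔ (lt_min hb (by norm_num)), min_le_left _ _,
    by norm_num, X ^ 2, admissible_X_sq, fun Δ' h1 h2 ↦ ?_⟩
  have hΔ'Δ : Δ' ≤ Δ := h2.le.trans (min_le_left _ _)
  have hΔ'b : Δ' < b := lt_of_lt_of_le h2 ((min_le_right _ _).trans (min_le_left _ _))
  have hΔ'2 : Δ' < 2 := lt_of_lt_of_le h2 ((min_le_right _ _).trans (min_le_right _ _))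
  have e1 : T₁ Δ' (X ^ 2) 1 = 0 :=
    hT₁ Δ' h1 (lt_min (lt_of_lt_of_le h2 (min_le_left _ _)) hΔ'2)
  obtain ⟨δ, hδ, hq⟩ := hband Δ' h1 hΔ'b
  set c₂ : ℝ := secondMomentForm Δ' (X ^ 2) 1 + T₂ Δ' (X ^ 2) 1 with hc₂
  have hlo : δ ≤ c₂ :=
    le_secondMainTerm_of_floorAlongGoodPrimes hMA admissible_X_sq h1 hΔ'Δ (by linarith)
      fun q₀ ↦ by
        obtain ⟨q, inst, hqge, hqp, hg, hfl, -⟩ := hq q₀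
        exact ⟨q, inst, hqge, hqp, hg, hfl⟩
  have hhi : c₂ ≤ 2 * linForm Δ' (X ^ 2) 1 ^ 2 - δ :=
    secondMainTerm_le_of_ceilingAlongGoodPrimes hMA admissible_X_sq h1 hΔ'Δ (by linarith)
      fun q₀ ↦ by
        obtain ⟨q, inst, hqge, hqp, hg, -, hce⟩ := hq q₀
        exact ⟨q, inst, hqge, hqp, hg, hce⟩
  rw [linForm_X_sq_one] at hhi
  rw [e1, add_zero, linForm_X_sq_one]
  have hc₂pos : 0 < c₂ := lt_of_lt_of_le hδ hlo
  rw [lt_div_iff₀ (by positivity)]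
  linarith

/-- **`Bettin →` the body of the value crux, from the band along good primes.** As
`beatsQuarter_of_bettin_of_secondDefect_average_X_sq`, with the averaged diagonal-only display replaced
by its one-sided consequence. [cite: KowalskiMichelVanderKam2000, Thm. 6.1 (32); §6 p. 19] [cite: Bettin2017, Thm. 1.1] -/
theorem beatsQuarter_of_bettin_of_bandAlongGoodPrimes_X_sq (hB : bettin2017_theorem11_primeLevel)
    (hS : MollifierMainTermAsymp (X ^ 2)) {b : ℝ} (hb : 1 < b)
    (hband : ∀ Δ' : ℝ, 1 < Δ' → Δ' < b → ∃ δ : ℝ, 0 < δ ∧ ∀ q₀ : ℕ, ∃ q : ℕ, ∃ _ : NeZero q,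
      q₀ ≤ q ∧ q.Prime ∧ (∀ n : ℕ, (n : ℝ) ≠ qhat q ^ Δ') ∧
        δ * ‖mainScale q Δ'‖ ≤ ‖QhPQ q (X ^ 2) 1 (qhat q ^ Δ')‖ ∧
          ‖QhPQ q (X ^ 2) 1 (qhat q ^ Δ')‖ ≤
            (2 * linForm Δ' (X ^ 2) 1 ^ 2 - δ) * ‖mainScale q Δ'‖) :
    ∀ Δ : ℝ, 1 < Δ → ∀ T₁ T₂ : ℝ → ℝ[X] → ℝ[X] → ℝ, MomentAsymptotics 1 Δ T₁ T₂ →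
      ∃ a' b' : ℝ, 1 ≤ a' ∧ a' < b' ∧ b' ≤ Δ ∧ a' < 3 / 2 ∧ ∃ P : ℝ[X], Admissible P ∧
        ∀ Δ' : ℝ, a' < Δ' → Δ' < b' →
          1 / 4 < (linForm Δ' P 1 + T₁ Δ' P 1) ^ 2 /
            (2 * (secondMomentForm Δ' P 1 + T₂ Δ' P 1)) :=
  fun Δ hΔ T₁ T₂ hMA ↦ beatsQuarter_window_of_bandAlongGoodPrimes_X_sq hb hband hΔ hMA
    (firstCorrectionVanishes_of_bettin hB hS Δ hΔ T₁ T₂ hMA)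

/-! ## §4. From the second defect to the band: «diagonal-only infinitely often» suffices -/

/-- **A small second defect puts the normalised second moment next to its diagonal value.** At a level
`q ≥ 40`: `|‖Q^h(P,Q)‖/‖mainScale q Δ'‖ − |secondMomentForm Δ' P Q|| ≤ secondDefect P Q Δ' q` (reverse
triangle inequality; `secondDefect = ‖Q^h − mainScale·second‖/‖mainScale‖`).
[cite: KowalskiMichelVanderKam2000, §6 p. 19 (second-moment display)] -/
theorem abs_normQhPQ_div_sub_abs_second_le_secondDefect (hq : 40 ≤ q) (P Q : ℝ[X]) {Δ' : ℝ}
    (hΔ' : 0 < Δ') :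
    |‖QhPQ q P Q (qhat q ^ Δ')‖ / ‖mainScale q Δ'‖ - (|secondMomentForm Δ' P Q|)| ≤
      secondDefect P Q Δ' q := by
  have hqhat1 : 1 < qhat q := one_lt_qhat hq
  have hlog : 0 < Real.log (qhat q) := Real.log_pos hqhat1
  have hqhat : 0 < qhat q := lt_trans one_pos hqhat1
  have hm : 0 < ‖mainScale q Δ'‖ := by rw [norm_mainScale hq]; positivity
  have hsd : secondDefect P Q Δ' q =
      ‖QhPQ q P Q (qhat q ^ Δ') - mainScale q Δ' * ((secondMomentForm Δ' P Q : ℝ) : ℂ)‖ /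
        ‖mainScale q Δ'‖ := by
    unfold secondDefect
    rw [dif_neg (NeZero.ne q)]
  have hprod : ‖mainScale q Δ' * ((secondMomentForm Δ' P Q : ℝ) : ℂ)‖ =
      ‖mainScale q Δ'‖ * |secondMomentForm Δ' P Q| := by
    rw [norm_mul, Complex.norm_real, Real.norm_eq_abs]
  have htri := abs_norm_sub_norm_le (QhPQ q P Q (qhat q ^ Δ'))
    (mainScale q Δ' * ((secondMomentForm Δ' P Q : ℝ) : ℂ))
  rw [hprod] at htri
  have e : ‖QhPQ q P Q (qhat q ^ Δ')‖ / ‖mainScale q Δ'‖ - (|secondMomentForm Δ' P Q|) =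
      (‖QhPQ q P Q (qhat q ^ Δ')‖ - ‖mainScale q Δ'‖ * (|secondMomentForm Δ' P Q|)) /
        ‖mainScale q Δ'‖ := by
    field_simp
  rw [hsd, e, abs_div, abs_of_pos hm]
  exact div_le_div_of_nonneg_right htri hm.le

/-- **«Diagonal-only infinitely often» at `(X², 1)` gives the band.** If for every `Δ' ∈ (1, b)` and
every `ε > 0` there are good primes `q` beyond any bound with `secondDefect X² 1 Δ' q ≤ ε` (the second
defect does not stay away from `0` along the good primes), then for every `Δ' ∈ (1, b)` the normalised
second moment lies in the band `[δ, 2·lin² − δ]` with `δ = 2(Δ'−1)/Δ'` (half the diagonal slack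
`2·lin² − second = 4(Δ'−1)/Δ'`; `second = 4 + 4/Δ'`, `lin = 2`) at good primes beyond any bound.
[cite: KowalskiMichelVanderKam2000, Thm. 6.1 (31)–(32) at P = X²; §6 p. 19] -/
theorem bandAlongGoodPrimes_X_sq_of_secondDefect_small_io {b : ℝ}
    (hio : ∀ Δ' : ℝ, 1 < Δ' → Δ' < b → ∀ ε : ℝ, 0 < ε → ∀ q₀ : ℕ, ∃ q : ℕ, ∃ _ : NeZero q,
      q₀ ≤ q ∧ q.Prime ∧ (∀ n : ℕ, (n : ℝ) ≠ qhat q ^ Δ') ∧ secondDefect (X ^ 2) 1 Δ' q ≤ ε) :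
    ∀ Δ' : ℝ, 1 < Δ' → Δ' < b → ∃ δ : ℝ, 0 < δ ∧ ∀ q₀ : ℕ, ∃ q : ℕ, ∃ _ : NeZero q,
      q₀ ≤ q ∧ q.Prime ∧ (∀ n : ℕ, (n : ℝ) ≠ qhat q ^ Δ') ∧
        δ * ‖mainScale q Δ'‖ ≤ ‖QhPQ q (X ^ 2) 1 (qhat q ^ Δ')‖ ∧
          ‖QhPQ q (X ^ 2) 1 (qhat q ^ Δ')‖ ≤
            (2 * linForm Δ' (X ^ 2) 1 ^ 2 - δ) * ‖mainScale q Δ'‖ := by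
  intro Δ' h1 h2
  have hΔ'0 : 0 < Δ' := by linarith
  set δ : ℝ := 2 * (Δ' - 1) / Δ' with hδ_def
  have hδ : 0 < δ := by rw [hδ_def]; exact div_pos (by linarith) hΔ'0
  refine ⟨δ, hδ, fun q₀ ↦ ?_⟩
  obtain ⟨q, inst, hqge, hq, hg, hsd⟩ := hio Δ' h1 h2 δ hδ (max q₀ 40)
  have hq40 : 40 ≤ q := le_trans (le_max_right _ _) hqge
  have hm : 0 < ‖mainScale q Δ'‖ := by
    rw [norm_mainScale hq40]
    have := lt_trans one_pos (one_lt_qhat hq40)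
    have := Real.log_pos (one_lt_qhat hq40)
    positivity
  refine ⟨q, inst, le_trans (le_max_left _ _) hqge, hq, hg, ?_, ?_⟩
  · have h := (abs_normQhPQ_div_sub_abs_second_le_secondDefect hq40 (X ^ 2) 1 hΔ'0).trans hsd
    rw [secondMomentForm_X_sq_one, abs_of_pos (by positivity : (0 : ℝ) < 4 + 4 / Δ')] at h
    have hr := (abs_le.1 h).1
    have h2δ : 2 * δ ≤ 4 + 4 / Δ' := by
      rw [hδ_def, show (4 : ℝ) + 4 / Δ' = (4 * Δ' + 4) / Δ' by field_simp,
        show (2 : ℝ) * (2 * (Δ' - 1) / Δ') = (4 * Δ' - 4) / Δ' by ring]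
      exact div_le_div_of_nonneg_right (by linarith) hΔ'0.le
    exact (le_div_iff₀ hm).1 (by linarith)
  · have h := (abs_normQhPQ_div_sub_abs_second_le_secondDefect hq40 (X ^ 2) 1 hΔ'0).trans hsd
    rw [secondMomentForm_X_sq_one, abs_of_pos (by positivity : (0 : ℝ) < 4 + 4 / Δ')] at h
    have hr := (abs_le.1 h).2
    have e : (2 : ℝ) * 2 ^ 2 - δ = 4 + 4 / Δ' + δ := by
      rw [hδ_def]
      field_simp
      ring
    rw [linForm_X_sq_one, e]
    exact (div_le_iff₀ hm).1 (by linarith)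

/-- **The averaged display gives «diagonal-only infinitely often».** If the second defect at `(P, Q, Δ')`
is `o(1)` on average over the good primes of dyadic blocks and good primes for `Δ'` are unbounded
(blocks `(N, 2N]` holding one exist for unboundedly many `N`), then for every `ε > 0` there are good
primes beyond any bound with `secondDefect P Q Δ' q ≤ ε` (an `ε`-average over a non-empty block has a
term `≤ ε`). [cite: KowalskiMichelVanderKam2000, §6 p. 19 (second-moment display); §2 p. 7 (M ∉ ℤ)] -/
theorem secondDefect_small_io_of_average {P Q : ℝ[X]} {Δ' : ℝ} (hgood : GoodPrimesUnbounded Δ')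
    (hav : ∀ ε : ℝ, 0 < ε → ∃ N₀ : ℕ, ∀ N : ℕ, N₀ ≤ N →
      ∑ q ∈ goodPrimes Δ' N, secondDefect P Q Δ' q ≤ ε * (goodPrimes Δ' N).card) :
    ∀ ε : ℝ, 0 < ε → ∀ q₀ : ℕ, ∃ q : ℕ, ∃ _ : NeZero q,
      q₀ ≤ q ∧ q.Prime ∧ (∀ n : ℕ, (n : ℝ) ≠ qhat q ^ Δ') ∧ secondDefect P Q Δ' q ≤ ε := by
  intro ε hε q₀
  obtain ⟨N₀, hN₀⟩ := hav ε hε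
  obtain ⟨N, hNge, hNne⟩ := exists_goodPrimes_nonempty hgood (max N₀ q₀)
  have hsum := hN₀ N (le_trans (le_max_left _ _) hNge)
  -- some term of the block is `≤ ε`
  have hsum' : ∑ q ∈ goodPrimes Δ' N, secondDefect P Q Δ' q ≤ ∑ _q ∈ goodPrimes Δ' N, ε := by
    rw [Finset.sum_const, nsmul_eq_mul, mul_comm]
    exact hsum
  obtain ⟨q, hqmem, hqle⟩ := Finset.exists_le_of_sum_le hNne hsum'
  rw [mem_goodPrimes_iff] at hqmem
  obtain ⟨hqN, -, hqp, hqg⟩ := hqmem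
  haveI : NeZero q := ⟨hqp.ne_zero⟩
  refine ⟨q, inferInstance, ?_, hqp, fun n ↦ by simpa [qhat] using hqg n, hqle⟩
  have := le_trans (le_max_right _ _) hNge
  omega

/-- **The chain of the line, weakest-first: averaged display at `(X², 1)` on `(1, b)` ⇒ «diagonal-only
infinitely often» ⇒ band.** (For `Δ' ∈ (1, b)` with `b ≤ 3` say — any `Δ' ∈ (0, 2]` has unbounded good
primes; here `Δ' < 2` is read off `b ≤ 2`.) [cite: KowalskiMichelVanderKam2000, §6 p. 19; §2 p. 7] -/
theorem bandAlongGoodPrimes_X_sq_of_secondDefect_average {b : ℝ} (hb2 : b ≤ 2)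
    (hav : ∀ Δ' : ℝ, 1 < Δ' → Δ' < b → ∀ ε : ℝ, 0 < ε → ∃ N₀ : ℕ, ∀ N : ℕ, N₀ ≤ N →
      ∑ q ∈ goodPrimes Δ' N, secondDefect (X ^ 2) 1 Δ' q ≤ ε * (goodPrimes Δ' N).card) :
    ∀ Δ' : ℝ, 1 < Δ' → Δ' < b → ∃ δ : ℝ, 0 < δ ∧ ∀ q₀ : ℕ, ∃ q : ℕ, ∃ _ : NeZero q,
      q₀ ≤ q ∧ q.Prime ∧ (∀ n : ℕ, (n : ℝ) ≠ qhat q ^ Δ') ∧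
        δ * ‖mainScale q Δ'‖ ≤ ‖QhPQ q (X ^ 2) 1 (qhat q ^ Δ')‖ ∧
          ‖QhPQ q (X ^ 2) 1 (qhat q ^ Δ')‖ ≤
            (2 * linForm Δ' (X ^ 2) 1 ^ 2 - δ) * ‖mainScale q Δ'‖ :=
  bandAlongGoodPrimes_X_sq_of_secondDefect_small_io fun Δ' h1 h2 ↦
    secondDefect_small_io_of_average
      (goodPrimesUnbounded_of_lt_two (by linarith) (lt_of_lt_of_le h2 hb2)) (hav Δ' h1 h2)

end Literature.NumberTheory.LFunctions.KMV2000
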